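/-
line stmt-HodgeConjecture-18881 Cruxes/BlochSeedDiscOne/Lines/birth.lean 814a6a70c14e831a stub_rung_pad4_seedAt

# UnipotentGap2Law — kernel shadow of memo `U-GAP2-unipotent1-g16.md` (hsemireg-alphabet-unipotent-1, generation 16)

EVIDENCE ONLY. Nothing in this file is a rung, and nothing here is proved toward HC / HC_CM / HC_AV / №4 / 26512 / 18881 / H2.
What is checked (Mathlib only; no `sorry`; no options; no instances / notation):
 §A  the counting core of the GAP-2 LAW (memo §1): survivor lengths of one world strictly increase with gaps ≥ 2, hence the s-th is
     ≥ 2s+1 (0-indexed) — `gap_two_growth` — and therefore at most ⌈i/2⌉ of them are ≤ i — `count_le_half`;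
 §B  the level-2 identity of LEVEL FORM v2 (memo §4.1): `level_two_identity`;
 §C  the complete analytic tail of THEOREM E₂ (memo §4.3): `QA_pos` proves, over ℝ, that the closed-form minorant
       Q_A(t,s,a,R) = K_A(t,a) + (48-2t)s + (2t-26)R + 2(s-2)⁺(s-R)⁺ + 4(s-a-4)⁺(s-a-2-R)⁺
     is > 2 for all real t ≥ 25, a ≥ 0, 0 ≤ R ≤ t+2 and ALL real s (variant A, β₂ ≥ 2) — a box containing the adversary box of
     memo §4.2 (s = σ−t ≥ 0, a = θ₂ ∈ [0,t], R ∈ [0, min(t+2,σ)]) — and `QB_pos` the same for variant B (β₂ = 1):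
       Q_B(t,s,a,R) = K_B(t,a) + (34-2t)s + (2t-12)R + 2(s-2)⁺(s-R)⁺ + 4(s-a-3)⁺(s-a-1-R)⁺ ,  t ≥ 18.
     Here K_A = 5/4 t² + 55/2 t + 2 + 13/4 a² − 41/2 a and K_B = 5/4 t² + 27/2 t + 2 + 13/4 a² − 13/2 a are the constants obtained in
     memo §4.3 from (48−2t)t [resp. (34−2t)t] + 13·((t²−2t)/4 + (a²−2a)/4) − 14t (− 14a) + 2, see `KA_eq` / `KB_eq`.
 §D  the GAP-2 LAW in combinatorial form over an ABSTRACT WORLD DATUM (memo §1(e); successor menu M1): `vworld_count` /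
     `uworld_count` — in one world of size c, survivors with val < len, val < c (resp. len − val ≤ c), distinct lengths, and val, len − val
     strictly increasing along length number at most min ⌈i/2⌉ c among lengths ≤ i — and `blocks_le_sum_worlds`: summed over a partition
     into worlds, #{blocks of length ≤ i} ≤ Σ_w min ⌈i/2⌉ (size w) (= T[⌈i/2⌉] + B[⌈i/2⌉] for the μ V-worlds β_a and t U-worlds m_k).
     The module theory delivering these hypotheses (memo §1(a)–(d): Ext-class, kill moves, sequential normal form) stays pen.
The pen content left in THEOREM E₂ is exactly the module-theoretic chain Ψ ≥ Φ''_{A/B} ≥ Q_{A/B} of memo §§2–4.2 (levers cap♯, cap♯∨,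
n₁ ≤ R, n₁∨ ≤ R∨, H = Σ u_x v_x, T3♯, Schur, tail pairing), each validated with 0 violations on 10 212 certified μ=2 modules (memo §5).
-/
import Mathlib

open Finset

namespace HsemiregAlphabetUnipotent1.G16

/-! ## §A  GAP-2 counting core -/

/-- If `ℓ 0 ≥ 1` and consecutive survivor lengths differ by at least 2, then `ℓ s ≥ 2 s + 1`. -/
theorem gap_two_growth (ℓ : ℕ → ℕ) (h0 : 1 ≤ ℓ 0) (hgap : ∀ s, ℓ s + 2 ≤ ℓ (s + 1)) (s : ℕ) :
    2 * s + 1 ≤ ℓ s := by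
  induction s with
  | zero => simpa using h0
  | succ n ih => have := hgap n; omega

/-- Hence among the first `m` survivors of a world, at most `(i+1)/2 = ⌈i/2⌉` have length `≤ i`. -/
theorem count_le_half (ℓ : ℕ → ℕ) (h0 : 1 ≤ ℓ 0) (hgap : ∀ s, ℓ s + 2 ≤ ℓ (s + 1)) (m i : ℕ) :
    ((range m).filter (fun s => ℓ s ≤ i)).card ≤ (i + 1) / 2 := by
  have hsub : (range m).filter (fun s => ℓ s ≤ i) ⊆ range ((i + 1) / 2) := by
    intro s hs
    rw [mem_filter] at hs
    rw [mem_range]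
    have h := gap_two_growth ℓ h0 hgap s
    omega
  exact (card_le_card hsub).trans (by simp)

/-- The world cap: survivors of a world of size `c` number at most `c`, so at most `min (⌈i/2⌉) c` have length `≤ i`. -/
theorem count_le_min (ℓ : ℕ → ℕ) (h0 : 1 ≤ ℓ 0) (hgap : ∀ s, ℓ s + 2 ≤ ℓ (s + 1)) (m c i : ℕ) (hm : m ≤ c) :
    ((range m).filter (fun s => ℓ s ≤ i)).card ≤ min ((i + 1) / 2) c := by
  refine le_min (count_le_half ℓ h0 hgap m i) ?_
  exact (card_le_card (filter_subset _ _)).trans (by simpa using hm)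

/-! ## §B  level-2 identity of the level form (memo §3 (M1)): with τ = σ + μ − R,
    −2στ + 2(σ−R)(σ−t) = −2(μ+t)σ + 2tR. -/
theorem level_two_identity (σ t μ R : ℤ) :
    2 * (σ - R) * (σ - t) - 2 * σ * (σ + μ - R) = -2 * (μ + t) * σ + 2 * t * R := by ring

/-! ## §C  analytic tail of THEOREM E₂ (memo §4.3) -/

noncomputable section

/-- positive part -/
def pp (x : ℝ) : ℝ := max x 0

theorem pp_nonneg (x : ℝ) : 0 ≤ pp x := le_max_right _ _
theorem pp_ge (x : ℝ) : x ≤ pp x := le_max_left _ _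
theorem pp_of_nonpos {x : ℝ} (h : x ≤ 0) : pp x = 0 := max_eq_right h
theorem pp_of_nonneg {x : ℝ} (h : 0 ≤ x) : pp x = x := max_eq_left h

/-- K_A(t,a): the constant of variant A. -/
def KA (t a : ℝ) : ℝ := 5/4 * t^2 + 55/2 * t + 2 + 13/4 * a^2 - 41/2 * a
/-- K_B(t,a): the constant of variant B. -/
def KB (t a : ℝ) : ℝ := 5/4 * t^2 + 27/2 * t + 2 + 13/4 * a^2 - 13/2 * a

theorem KA_eq (t a : ℝ) :
    KA t a = (48 - 2*t) * t + 13 * ((t^2 - 2*t)/4 + (a^2 - 2*a)/4) - 14*t - 14*a + 2 := by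
  unfold KA; ring
theorem KB_eq (t a : ℝ) :
    KB t a = (34 - 2*t) * t + 13 * ((t^2 - 2*t)/4 + (a^2 - 2*a)/4) - 14*t + 2 := by
  unfold KB; ring

/-- Q_A: the closed-form minorant of Φ''_A (variant A, β₂ ≥ 2). -/
def QA (t s a R : ℝ) : ℝ :=
  KA t a + (48 - 2*t) * s + (2*t - 26) * R + 2 * pp (s - 2) * pp (s - R) + 4 * pp (s - a - 4) * pp (s - a - 2 - R)
/-- Q_B: the closed-form minorant of Φ''_B (variant B, β₂ = 1). -/
def QB (t s a R : ℝ) : ℝ :=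
  KB t a + (34 - 2*t) * s + (2*t - 12) * R + 2 * pp (s - 2) * pp (s - R) + 4 * pp (s - a - 3) * pp (s - a - 1 - R)

/-- completed square for K_A in a. -/
theorem KA_lb (t a : ℝ) : 5/4 * t^2 + 55/2 * t + 2 - 1681/52 ≤ KA t a := by
  unfold KA; nlinarith [sq_nonneg (a - 41/13)]
theorem KB_lb (t a : ℝ) : 5/4 * t^2 + 27/2 * t + 2 - 13/4 ≤ KB t a := by
  unfold KB; nlinarith [sq_nonneg (a - 1)]

/-- P1 ≥ 2(s−2)(s−R) whenever R ≤ s. -/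
theorem P1_lb (s R : ℝ) (h : R ≤ s) : 2 * (s - 2) * (s - R) ≤ 2 * pp (s - 2) * pp (s - R) := by
  rw [pp_of_nonneg (sub_nonneg.2 h)]
  have : (s - 2) * (s - R) ≤ pp (s - 2) * (s - R) :=
    mul_le_mul_of_nonneg_right (pp_ge _) (sub_nonneg.2 h)
  nlinarith [this]

/-- the variant-A core once the positive parts are resolved (memo §4.3, case (ii)):
    Φ0 + R·m > 0 with Φ0 = K + (44−2t)s + 2s² + 4p² + 8p, m = 2t − 22 − 2s − 4p, where p = 0 or p = s − a − 4 > 0. -/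
theorem coreA (t s a R p : ℝ) (ht : 25 ≤ t) (ha : 0 ≤ a) (hR0 : 0 ≤ R) (hR1 : R ≤ t + 2) (hRs : R ≤ s)
    (hp : p = 0 ∨ (p = s - a - 4 ∧ 0 < p)) :
    2 < KA t a + (44 - 2*t) * s + 2 * s^2 + 4 * p^2 + 8 * p + R * (2*t - 22 - 2*s - 4*p) := by
  have hK := KA_lb t a
  rcases hp with hp | ⟨hp, hp0⟩
  · subst hp
    by_cases hm : 0 ≤ 2*t - 22 - 2*s
    · -- drop the R-term; complete the square in s
      nlinarith [mul_nonneg hR0 hm, sq_nonneg (s - (t - 22)/2)]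
    · rw [not_le] at hm
      by_cases hst : s ≤ t + 2
      · -- R ≤ s : R·m ≥ s·m, total K + 22 s
        nlinarith [mul_nonneg (sub_nonneg.2 hRs) (le_of_lt (neg_pos.2 hm))]
      · rw [not_le] at hst
        -- R ≤ t+2 : total ≥ K + 22t + 44 + 2(s−t−2)(s−t+22)
        nlinarith [mul_nonneg (sub_nonneg.2 hR1) (le_of_lt (neg_pos.2 hm)),
                   mul_nonneg (le_of_lt (sub_pos.2 hst)) (show (0:ℝ) ≤ s - t + 22 by linarith)]
  · subst hp
    -- s = p + a + 4 with p > 0 ; G(a,p) := Φ0 ;  SOS identities of memo §4.3 (B2, B4)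
    have hG : KA t a + (44 - 2*t) * s + 2 * s^2 + 4 * (s-a-4)^2 + 8 * (s-a-4)
        = 6 * ((s-a-4) - (13*t-556)/110 + (a - (16*t-202)/110)/3)^2 + 55/12 * (a - (16*t-202)/110)^2
          + (217/220 * t^2 + 3661/110 * t + 413/220) := by unfold KA; ring
    by_cases hm : 0 ≤ 2*t - 22 - 2*s - 4*(s-a-4)
    · nlinarith [mul_nonneg hR0 hm, sq_nonneg ((s-a-4) - (13*t-556)/110 + (a - (16*t-202)/110)/3),
                 sq_nonneg (a - (16*t-202)/110)]
    · rw [not_le] at hm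
      -- boundary quadratic f(a) = 29/4 a² − (4t+9/2) a + 5/4 t² + 83/2 t + 62 = 29/4 (a − (8t+9)/29)² + (81/116 t² + 2335/58 t + 7111/116)
      have hf : ∀ a' : ℝ, 29/4 * a'^2 - (4*t + 9/2) * a' + 5/4 * t^2 + 83/2 * t + 62
          = 29/4 * (a' - (8*t+9)/29)^2 + (81/116 * t^2 + 2335/58 * t + 7111/116) := by intro a'; ring
      by_cases hst : s ≤ t + 2
      · -- R·m ≥ s·m ; Φ0 + s m = 5/4 t² + 55/2 t + 90 + 13/4 a² − 4pa + 3/2 a + 14 p =: G5, linear in p with slope 14 − 4a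
        have hG5 : KA t a + (44 - 2*t) * s + 2 * s^2 + 4 * (s-a-4)^2 + 8 * (s-a-4) + s * (2*t - 22 - 2*s - 4*(s-a-4))
            = 5/4 * t^2 + 55/2 * t + 90 + 13/4 * a^2 - 4 * (s-a-4) * a + 3/2 * a + 14 * (s-a-4) := by unfold KA; ring
        by_cases ha35 : a ≤ 7/2
        · nlinarith [mul_nonneg (sub_nonneg.2 hRs) (le_of_lt (neg_pos.2 hm)),
                     mul_nonneg (le_of_lt hp0) (show (0:ℝ) ≤ 14 - 4*a by linarith), sq_nonneg a]
        · rw [not_le] at ha35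
          -- p ≤ t − 2 − a ; value at p = t−2−a is f(a)
          have hpa : s - a - 4 ≤ t - 2 - a := by linarith
          nlinarith [mul_nonneg (sub_nonneg.2 hRs) (le_of_lt (neg_pos.2 hm)),
                     mul_nonneg (sub_nonneg.2 hpa) (show (0:ℝ) ≤ 4*a - 14 by linarith),
                     hf a, sq_nonneg (a - (8*t+9)/29)]
      · rw [not_le] at hst
        -- R·m ≥ (t+2)·m ; Φ0 + (t+2) m = G4(a,p), a convex quadratic whose free minimiser violates p + a ≥ t − 2, so its minimum
        -- on that half-plane sits on the boundary: KKT certificate (memo §4.3 B4) with multiplier λ_A(t) = (52t+856)/29 ≥ 0.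
        have hcert : KA t a + (44 - 2*t) * s + 2 * s^2 + 4 * (s-a-4)^2 + 8 * (s-a-4) + (t+2) * (2*t - 22 - 2*s - 4*(s-a-4))
            = 6 * (((s-a-4) - (21*t-67)/29) + (a - (8*t+9)/29)/3)^2 + 55/12 * (a - (8*t+9)/29)^2
              + (52*t+856)/29 * ((s-a-4) + a - (t-2)) + (81/116 * t^2 + 2335/58 * t + 7111/116) := by
          unfold KA; ring
        nlinarith [mul_nonneg (sub_nonneg.2 hR1) (le_of_lt (neg_pos.2 hm)), hcert,
                   sq_nonneg (((s-a-4) - (21*t-67)/29) + (a - (8*t+9)/29)/3), sq_nonneg (a - (8*t+9)/29),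
                   mul_nonneg (show (0:ℝ) ≤ (52*t+856)/29 by positivity) (show (0:ℝ) ≤ (s-a-4) + a - (t-2) by linarith)]

/-- **THEOREM E₂, analytic tail, variant A** (memo §4.3): Q_A > 2 on the whole adversary box (so the integer Ψ ≥ Φ''_A ≥ Q_A forces Ψ ≥ 3 there). -/
theorem QA_pos (t s a R : ℝ) (ht : 25 ≤ t) (ha : 0 ≤ a) (hR0 : 0 ≤ R) (hR1 : R ≤ t + 2) :
    2 < QA t s a R := by
  unfold QA
  have hK := KA_lb t a
  have hP2 : 0 ≤ 4 * pp (s - a - 4) * pp (s - a - 2 - R) := by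
    have := pp_nonneg (s - a - 4); have := pp_nonneg (s - a - 2 - R); positivity
  by_cases hRs : s ≤ R
  · -- case (i): P1 = 0
    rw [pp_of_nonpos (sub_nonpos.2 hRs)]
    nlinarith [hP2]
  · rw [not_le] at hRs
    have hP1 := P1_lb s R (le_of_lt hRs)
    by_cases hp : s - a - 4 ≤ 0
    · rw [pp_of_nonpos hp]
      have h := coreA t s a R 0 ht ha hR0 hR1 (le_of_lt hRs) (Or.inl rfl)
      nlinarith [h, hP1]
    · rw [not_le] at hp
      rw [pp_of_nonneg (le_of_lt hp)]
      have hq : (s - a - 4) * (s - a - 2 - R) ≤ (s - a - 4) * pp (s - a - 2 - R) :=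
        mul_le_mul_of_nonneg_left (pp_ge _) (le_of_lt hp)
      have h := coreA t s a R (s - a - 4) ht ha hR0 hR1 (le_of_lt hRs) (Or.inr ⟨rfl, hp⟩)
      nlinarith [h, hP1, hq]

/-- variant-B core (memo §4.3, constants of Q_B). -/
theorem coreB (t s a R p : ℝ) (ht : 18 ≤ t) (ha : 0 ≤ a) (hR0 : 0 ≤ R) (hR1 : R ≤ t + 2) (hRs : R ≤ s)
    (hp : p = 0 ∨ (p = s - a - 3 ∧ 0 < p)) :
    2 < KB t a + (30 - 2*t) * s + 2 * s^2 + 4 * p^2 + 8 * p + R * (2*t - 8 - 2*s - 4*p) := by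
  have hK := KB_lb t a
  rcases hp with hp | ⟨hp, hp0⟩
  · subst hp
    by_cases hm : 0 ≤ 2*t - 8 - 2*s
    · nlinarith [mul_nonneg hR0 hm, sq_nonneg (s - (t - 15)/2)]
    · rw [not_le] at hm
      by_cases hst : s ≤ t + 2
      · nlinarith [mul_nonneg (sub_nonneg.2 hRs) (le_of_lt (neg_pos.2 hm))]
      · rw [not_le] at hst
        nlinarith [mul_nonneg (sub_nonneg.2 hR1) (le_of_lt (neg_pos.2 hm)),
                   mul_nonneg (le_of_lt (sub_pos.2 hst)) (show (0:ℝ) ≤ s - t + 15 by linarith)]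
  · subst hp
    have hG : KB t a + (30 - 2*t) * s + 2 * s^2 + 4 * (s-a-3)^2 + 8 * (s-a-3)
        = 6 * ((s-a-3) - (13*t-383)/110 + (a - (16*t-226)/110)/3)^2 + 55/12 * (a - (16*t-226)/110)^2
          + (217/220 * t^2 + 2043/110 * t - 2973/220) := by unfold KB; ring
    by_cases hm : 0 ≤ 2*t - 8 - 2*s - 4*(s-a-3)
    · nlinarith [mul_nonneg hR0 hm, sq_nonneg ((s-a-3) - (13*t-383)/110 + (a - (16*t-226)/110)/3),
                 sq_nonneg (a - (16*t-226)/110)]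
    · rw [not_le] at hm
      have hf : ∀ a' : ℝ, 29/4 * a'^2 + (3/2 - 4*t) * a' + 5/4 * t^2 + 63/2 * t + 50
          = 29/4 * (a' - (8*t-3)/29)^2 + (81/116 * t^2 + 1851/58 * t + 5791/116) := by intro a'; ring
      by_cases hst : s ≤ t + 2
      · have hG5 : KB t a + (30 - 2*t) * s + 2 * s^2 + 4 * (s-a-3)^2 + 8 * (s-a-3) + s * (2*t - 8 - 2*s - 4*(s-a-3))
            = 5/4 * t^2 + 27/2 * t + 68 + 13/4 * a^2 - 4 * (s-a-3) * a + 31/2 * a + 18 * (s-a-3) := by unfold KB; ring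
        by_cases ha45 : a ≤ 9/2
        · nlinarith [mul_nonneg (sub_nonneg.2 hRs) (le_of_lt (neg_pos.2 hm)),
                     mul_nonneg (le_of_lt hp0) (show (0:ℝ) ≤ 18 - 4*a by linarith), sq_nonneg a]
        · rw [not_le] at ha45
          have hpa : s - a - 3 ≤ t - 1 - a := by linarith
          nlinarith [mul_nonneg (sub_nonneg.2 hRs) (le_of_lt (neg_pos.2 hm)),
                     mul_nonneg (sub_nonneg.2 hpa) (show (0:ℝ) ≤ 4*a - 18 by linarith),
                     hf a, sq_nonneg (a - (8*t-3)/29)]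
      · rw [not_le] at hst
        -- KKT certificate on p′ + a ≥ t − 1 with multiplier λ_B(t) = (52t+778)/29 ≥ 0 (memo §4.3 B4, variant B).
        have hcert : KB t a + (30 - 2*t) * s + 2 * s^2 + 4 * (s-a-3)^2 + 8 * (s-a-3) + (t+2) * (2*t - 8 - 2*s - 4*(s-a-3))
            = 6 * (((s-a-3) - (21*t-26)/29) + (a - (8*t-3)/29)/3)^2 + 55/12 * (a - (8*t-3)/29)^2
              + (52*t+778)/29 * ((s-a-3) + a - (t-1)) + (81/116 * t^2 + 1851/58 * t + 5791/116) := by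
          unfold KB; ring
        nlinarith [mul_nonneg (sub_nonneg.2 hR1) (le_of_lt (neg_pos.2 hm)), hcert,
                   sq_nonneg (((s-a-3) - (21*t-26)/29) + (a - (8*t-3)/29)/3), sq_nonneg (a - (8*t-3)/29),
                   mul_nonneg (show (0:ℝ) ≤ (52*t+778)/29 by positivity) (show (0:ℝ) ≤ (s-a-3) + a - (t-1) by linarith)]

/-- **THEOREM E₂, analytic tail, variant B** (memo §4.3): Q_B > 2 on the whole adversary box. -/
theorem QB_pos (t s a R : ℝ) (ht : 18 ≤ t) (ha : 0 ≤ a) (hR0 : 0 ≤ R) (hR1 : R ≤ t + 2) :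
    2 < QB t s a R := by
  unfold QB
  have hK := KB_lb t a
  have hP2 : 0 ≤ 4 * pp (s - a - 3) * pp (s - a - 1 - R) := by
    have := pp_nonneg (s - a - 3); have := pp_nonneg (s - a - 1 - R); positivity
  by_cases hRs : s ≤ R
  · rw [pp_of_nonpos (sub_nonpos.2 hRs)]
    nlinarith [hP2]
  · rw [not_le] at hRs
    have hP1 := P1_lb s R (le_of_lt hRs)
    by_cases hp : s - a - 3 ≤ 0
    · rw [pp_of_nonpos hp]
      have h := coreB t s a R 0 ht ha hR0 hR1 (le_of_lt hRs) (Or.inl rfl)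
      nlinarith [h, hP1]
    · rw [not_le] at hp
      rw [pp_of_nonneg (le_of_lt hp)]
      have hq : (s - a - 3) * (s - a - 1 - R) ≤ (s - a - 3) * pp (s - a - 1 - R) :=
        mul_le_mul_of_nonneg_left (pp_ge _) (le_of_lt hp)
      have h := coreB t s a R (s - a - 3) ht ha hR0 hR1 (le_of_lt hRs) (Or.inr ⟨rfl, hp⟩)
      nlinarith [h, hP1, hq]

end

/-! ### The GAP-2 LAW, combinatorial form (memo §1(e)) over an abstract world datum
The module theory of memo §1(a)–(d) (Ext-class, kill moves, sequential normal form) is pen; what it delivers per world is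
exactly the hypothesis list of `vworld_count` / `uworld_count` below, and the cap `n_{≤i}(K) ≤ T[⌈i/2⌉] + B[⌈i/2⌉]` is
`blocks_le_sum_worlds`. -/
section WorldCount

/-- **V-world capacity and gap-2 count** (memo §1(e)).  A «world» after sequential normal form: surviving blocks `j ∈ S`
with lengths `len j` and values `val j < len j`, values below the world size `c`, distinct blocks of distinct length, and the
antichain monotonicities: along increasing length both `val` and `len - val` strictly increase.  Then at most
`min ⌈i/2⌉ c` survivors have length `≤ i`. -/
theorem vworld_count {α : Type*} [DecidableEq α] (S : Finset α) (len val : α → ℕ) (c i : ℕ)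
    (hval : ∀ j ∈ S, val j < len j) (hcap : ∀ j ∈ S, val j < c)
    (hne : ∀ j ∈ S, ∀ j' ∈ S, j ≠ j' → len j ≠ len j')
    (hv : ∀ j ∈ S, ∀ j' ∈ S, len j < len j' → val j < val j')
    (hlv : ∀ j ∈ S, ∀ j' ∈ S, len j < len j' → len j - val j < len j' - val j') :
    (S.filter (fun j => len j ≤ i)).card ≤ min ((i + 1) / 2) c := by
  set Si := S.filter (fun j => len j ≤ i) with hSi
  have hsub : ∀ j ∈ Si, j ∈ S ∧ len j ≤ i := fun j hj => by simpa [hSi] using hj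
  -- gap 2 along increasing length
  have hgap : ∀ j ∈ S, ∀ j' ∈ S, len j < len j' → len j + 2 ≤ len j' := by
    intro j hj j' hj' hlt
    have h1 := hv j hj j' hj' hlt
    have h2 := hlv j hj j' hj' hlt
    have h3 := hval j hj
    have h4 := hval j' hj'
    omega
  -- (1) capacity: val is injective on Si into range c
  have hcapc : Si.card ≤ c := by
    have hmaps : ∀ j ∈ Si, val j ∈ range c := fun j hj => by
      have := hcap j (hsub j hj).1; simpa using this
    have hinj : Set.InjOn val ↑Si := by
      intro j hj j' hj' hvv
      by_contra hjj
      have hS := (hsub j hj).1; have hS' := (hsub j' hj').1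
      have hlen := hne j hS j' hS' hjj
      rcases lt_or_gt_of_ne hlen with h | h
      · exact absurd hvv (ne_of_lt (hv j hS j' hS' h))
      · exact absurd hvv (ne_of_gt (hv j' hS' j hS h))
    have := Finset.card_le_card_of_injOn val hmaps hinj
    simpa using this
  -- (2) gap-2: j ↦ (len j + 1) / 2 is injective on Si into Icc 1 ((i+1)/2)
  have hhalf : Si.card ≤ (i + 1) / 2 := by
    have hmaps : ∀ j ∈ Si, (len j + 1) / 2 ∈ Icc 1 ((i + 1) / 2) := fun j hj => by
      have hS := (hsub j hj).1; have hle := (hsub j hj).2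
      have h1 : 1 ≤ len j := by have := hval j hS; omega
      simp only [mem_Icc]
      constructor <;> omega
    have hinj : Set.InjOn (fun j => (len j + 1) / 2) ↑Si := by
      intro j hj j' hj' hvv
      by_contra hjj
      have hS := (hsub j hj).1; have hS' := (hsub j' hj').1
      have hlen := hne j hS j' hS' hjj
      simp only at hvv
      rcases lt_or_gt_of_ne hlen with h | h
      · have := hgap j hS j' hS' h; omega
      · have := hgap j' hS' j hS h; omega
    have := Finset.card_le_card_of_injOn (fun j => (len j + 1) / 2) hmaps hinj
    simpa using this
  exact le_min hhalf hcapc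

/-- **U-world** version (memo §1(e)): values `val j ∈ [(len j - c)⁺, len j - 1]`, i.e. `len j - val j ≤ c`, same monotonicities.
Reduced to `vworld_count` with the reflected value `len j - val j - 1`. -/
theorem uworld_count {α : Type*} [DecidableEq α] (S : Finset α) (len val : α → ℕ) (c i : ℕ)
    (hval : ∀ j ∈ S, val j < len j) (hcap : ∀ j ∈ S, len j - val j ≤ c)
    (hne : ∀ j ∈ S, ∀ j' ∈ S, j ≠ j' → len j ≠ len j')
    (hv : ∀ j ∈ S, ∀ j' ∈ S, len j < len j' → val j < val j')
    (hlv : ∀ j ∈ S, ∀ j' ∈ S, len j < len j' → len j - val j < len j' - val j') :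
    (S.filter (fun j => len j ≤ i)).card ≤ min ((i + 1) / 2) c := by
  refine vworld_count S len (fun j => len j - val j - 1) c i ?_ ?_ hne ?_ ?_
  · intro j hj; have := hval j hj; show len j - val j - 1 < len j; omega
  · intro j hj; have := hcap j hj; have := hval j hj; show len j - val j - 1 < c; omega
  · intro j hj j' hj' h; have := hlv j hj j' hj' h; have := hval j hj; have := hval j' hj'
    show len j - val j - 1 < len j' - val j' - 1; omega
  · intro j hj j' hj' h; have := hv j hj j' hj' h; have := hval j hj; have := hval j' hj'
    have := hlv j hj j' hj' h; show len j - (len j - val j - 1) < len j' - (len j' - val j' - 1); omega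

/-- **GAP-2 LAW, combinatorial form** (memo §1(e), summed over worlds): if the blocks of `K` are partitioned among worlds
(`world : α → W`), world `w` having size `size w`, and inside each world the survivors satisfy the hypotheses of
`vworld_count` / `uworld_count` (packaged as the per-world bound `hworld`), then
`#{blocks of length ≤ i} ≤ Σ_w min ⌈i/2⌉ (size w)` — which is `T[⌈i/2⌉] + B[⌈i/2⌉]` when the worlds are the `μ` V-worlds of
sizes `β_a` and the `t` U-worlds of sizes `m_k`. -/
theorem blocks_le_sum_worlds {α W : Type*} [DecidableEq α] [DecidableEq W] [Fintype W]
    (S : Finset α) (len : α → ℕ) (world : α → W) (size : W → ℕ) (i : ℕ)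
    (hworld : ∀ w : W, ((S.filter (fun j => world j = w)).filter (fun j => len j ≤ i)).card ≤ min ((i + 1) / 2) (size w)) :
    (S.filter (fun j => len j ≤ i)).card ≤ ∑ w, min ((i + 1) / 2) (size w) := by
  classical
  have hfib : (S.filter (fun j => len j ≤ i)).card
      = ∑ w, ((S.filter (fun j => len j ≤ i)).filter (fun j => world j = w)).card := by
    rw [← Finset.card_eq_sum_card_fiberwise (f := world) (s := S.filter (fun j => len j ≤ i)) (t := Finset.univ)]
    intro j _; exact Finset.mem_univ _
  rw [hfib]
  refine Finset.sum_le_sum (fun w _ => ?_)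
  have hswap : ((S.filter (fun j => len j ≤ i)).filter (fun j => world j = w))
      = ((S.filter (fun j => world j = w)).filter (fun j => len j ≤ i)) := by
    ext j; simp only [mem_filter]; tauto
  rw [hswap]; exact hworld w

end WorldCount

end HsemiregAlphabetUnipotent1.G16
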